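import Literature.NumberTheory.Transcendental.NesterenkoUResultantIntegral
import Literature.NumberTheory.Transcendental.NesterenkoIntegerHeights
import Mathlib.RingTheory.LocalRing.LocalSubring
import Mathlib.RingTheory.Localization.AtPrime.Basic
import Mathlib.Analysis.Complex.Polynomial.Basic
import HarnessLib

/-!
# The `u`-resultant of the Chow form of a prime with a form, III: specialisations (towards LNM 1752 Ch. 3 Prop. 4.11, route B)

`Literature/NumberTheory/Transcendental/NesterenkoUResultantSpecialize.lean`. Sequel of
`NesterenkoUResultantIntegral.lean`. There the `u`-resultant `G = uResultant 𝔭 s d Q₀ ∈ A =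
ℚ[u₁, …, u_s]` of a homogeneous prime `𝔭` of dimension `s` with an integer form `Q₀` of degree
`d` was constructed, with `G = c^d ∏_{i<D} Q₀(β⁽ⁱ⁾)` in `Ω = ℚ(u₁, …, u_s)‾` for the splitting
`F(u₁, …, u_s; ·) = c ∏ (β⁽ⁱ⁾ · u_{s+1})` of the associated form over the generic linear section.
All estimates and divisibilities of Prop. 4.11 are read off from SPECIALISATIONS of this identity,
`u ↦ z`, and this file provides the two kinds that are needed:

* `exists_split_primeSpec` — **at the generic point of a hypersurface `P = 0`** (`P ∈ A` prime):
  there is a field `k̄_P` (`primeSpecField`, algebraically closed of characteristic `0`) and a ring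
  homomorphism `φ̄_P : A → k̄_P` with KERNEL EXACTLY `(P)` (`ker_primeSpecMap`) such that
  `F(φ̄_P(u); ·) = cz ∏ (bz⁽ⁱ⁾ · u_{s+1})` and `φ̄_P(G) = cz^d ∏ Q₀(bz⁽ⁱ⁾)` with every `bz⁽ⁱ⁾ ≠ 0` a
  zero of `𝔭` on the hyperplanes `φ̄_P(u₁), …, φ̄_P(u_s)`. Construction: a valuation ring `V` of
  `Ω` dominating the local ring `A_(P)` (Chevalley, `LocalSubring.exists_le_valuationSubring`),
  normalisation of the splitting inside `V` (`exists_integral_split`) and reduction modulo the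
  maximal ideal of `V`; `k̄_P` is an algebraic closure of the residue field of `V`.
* `exists_split_complexSpec` — **at a complex point `z` at which `A → ℂ`, `u ↦ z`, is
  injective** (a generic point): an embedding `Ω → ℂ` over `u ↦ z` (`IsFractionRing.lift`,
  `IsAlgClosed.lift`) transports the identity verbatim: `F(z; ·) = cz ∏ (bz⁽ⁱ⁾ · u_{s+1})`,
  `G(z) = cz^d ∏ Q₀(bz⁽ⁱ⁾)`, `cz ≠ 0`, `bz⁽ⁱ⁾ ∈ V_ℂ(𝔭) ∖ 0` on the hyperplanes `z₁, …, z_s`.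

Also: zeros of the homogeneous ideal `𝔭` are stable under scaling and transport along ring
homomorphisms (through integer models of its elements).

Definitions: `primeSpecVal`, `primeSpecField`, `primeSpecMap` (plumbing with bodies); no named
facts.

## References

* [NesterenkoPhilippon2001] Yu. V. Nesterenko, P. Philippon (eds.), *Introduction to Algebraic
  Independence Theory*, LNM 1752, Springer 2001, Ch. 3 §4, Prop. 4.11 (pp. 40–41).
* [Nes10] Yu. V. Nesterenko, Proc. Steklov Inst. Math. 218 (1997) 294–331, Prop. 1.4.
* O. Zariski, P. Samuel, *Commutative Algebra* II, Ch. VI (places and specialisations).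
-/

noncomputable section

open MvPolynomial

attribute [local instance] MvPolynomial.gradedAlgebra

namespace Literature.NumberTheory.Transcendental

namespace Nesterenko

variable {m : ℕ}

/-! ### Zeros of `𝔭`: scaling and transport -/

/-- `P(c β) = c^d P(β)` for a rational form `P` of degree `d`, in any commutative `ℚ`-algebra.
[folklore] -/
theorem aeval_smul_of_isHomogeneous_rat {S : Type*} [CommRing S] [Algebra ℚ S]
    {P : Rx m} {d : ℕ} (hP : P.IsHomogeneous d) (c : S) (β : Fin (m + 1) → S) :
    aeval (c • β) P = c ^ d * aeval β P := by
  classical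
  rw [aeval_def, aeval_def, eval₂_eq', eval₂_eq', Finset.mul_sum]
  refine Finset.sum_congr rfl fun e he => ?_
  have hsd : ∑ i, e i = d := by
    have h := hP (mem_support_iff.1 he)
    rw [Finsupp.weight_apply, Finsupp.sum_fintype _ _ (fun i => by simp)] at h
    simpa using h
  simp only [Pi.smul_apply, smul_eq_mul, mul_pow, Finset.prod_mul_distrib,
    Finset.prod_pow_eq_pow_sum, hsd]
  ring

/-- A zero of a homogeneous ideal stays a zero after scaling (any commutative `ℚ`-algebra).
[folklore] -/
theorem forall_aeval_smul_eq_zero {S : Type*} [CommRing S] [Algebra ℚ S] {𝔭 : Ideal (Rx m)}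
    (hhom : 𝔭.IsHomogeneous (homogeneousSubmodule (Fin (m + 1)) ℚ)) {β : Fin (m + 1) → S}
    (hβ : ∀ P ∈ 𝔭, aeval β P = 0) (c : S) : ∀ P ∈ 𝔭, aeval (c • β) P = 0 := by
  intro P hP
  rw [← sum_homogeneousComponent P, map_sum]
  refine Finset.sum_eq_zero fun n _ => ?_
  rw [aeval_smul_of_isHomogeneous_rat (homogeneousComponent_isHomogeneous n P),
    hβ _ (homogeneousComponent_mem_of_mem hhom hP n), mul_zero]

/-- Zeros of an ideal of `ℚ[x̲]` in terms of the INTEGER polynomials of the ideal (any commutative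
`ℚ`-algebra): `β̄` kills `𝔭` iff it kills every `Z ∈ ℤ[x̲]` whose image lies in `𝔭`. [folklore] -/
theorem forall_aeval_eq_zero_iff_int {S : Type*} [CommRing S] [Algebra ℚ S] (𝔭 : Ideal (Rx m))
    (β : Fin (m + 1) → S) :
    (∀ P ∈ 𝔭, aeval β P = 0) ↔
      ∀ Z : MvPolynomial (Fin (m + 1)) ℤ, MvPolynomial.map (Int.castRingHom ℚ) Z ∈ 𝔭 →
        aeval β Z = 0 := by
  constructor
  · intro h Z hZ
    have := h _ hZ
    rwa [← algebraMap_int_eq, aeval_map_algebraMap] at this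
  · intro h P hP
    by_cases hP0 : P = 0
    · rw [hP0, map_zero]
    obtain ⟨c, hc, Z, hPZ, -, -⟩ := exists_eq_C_mul_map_primitive P hP0
    have hZ : MvPolynomial.map (Int.castRingHom ℚ) Z ∈ 𝔭 := by
      have : MvPolynomial.map (Int.castRingHom ℚ) Z = C c⁻¹ * P := by
        rw [hPZ, ← mul_assoc, ← map_mul, inv_mul_cancel₀ hc, C_1, one_mul]
      rw [this]
      exact 𝔭.mul_mem_left _ hP
    rw [hPZ, map_mul, ← algebraMap_int_eq, aeval_map_algebraMap, h Z hZ, mul_zero]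

/-- **Transport of zeros of `𝔭` along a ring homomorphism.** If the coordinates of a zero `β̄` of
`𝔭` in a `ℚ`-algebra `S` lie in a subring `V` and `ψ : V → T` is a ring homomorphism, then
`ψ(β̄)` kills every integer polynomial of `𝔭`. [folklore] -/
theorem forall_aeval_map_eq_zero {S T : Type*} [CommRing S] [Algebra ℚ S] [CommRing T]
    (V : Subring S) (ψ : V →+* T) {𝔭 : Ideal (Rx m)} (β : Fin (m + 1) → V)
    (hβ : ∀ P ∈ 𝔭, aeval (fun j => (β j : S)) P = 0) :
    ∀ Z : MvPolynomial (Fin (m + 1)) ℤ, MvPolynomial.map (Int.castRingHom ℚ) Z ∈ 𝔭 →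
      aeval (fun j => ψ (β j)) Z = 0 := by
  rw [forall_aeval_eq_zero_iff_int] at hβ
  intro Z hZ
  have h1 : V.subtype (aeval β Z) = 0 := by
    rw [map_aeval_int]
    exact hβ Z hZ
  have h2 : aeval β Z = 0 := by
    have : Function.Injective V.subtype := Subtype.coe_injective
    exact this (by rw [h1, map_zero])
  rw [← map_aeval_int ψ Z β, h2, map_zero]

/-- A ring homomorphism maps `c ∏ (β⁽ⁱ⁾ · u)` to `φ(c) ∏ (φβ⁽ⁱ⁾ · u)` (commutative-ring
source). [folklore] -/
theorem map_C_mul_prod_lin' {R L : Type*} [CommRing R] [CommRing L] (φ : R →+* L) (c : R)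
    {D : ℕ} (β : Fin D → Fin (m + 1) → R) :
    MvPolynomial.map φ (C c * ∏ i, (∑ j, C (β i j) * X j)) =
      C (φ c) * ∏ i, (∑ j, C (φ (β i j)) * X j : MvPolynomial (Fin (m + 1)) L) := by
  simp [map_prod, map_sum]

/-! ### Specialisation at the generic point of a hypersurface `P = 0` -/

section PrimeSpec

variable {s : ℕ} {P : RU s m}

/-- The prime ideal `(P)`. [folklore] -/
theorem isPrime_span_of_prime (hP : Prime P) : (Ideal.span {P} : Ideal (RU s m)).IsPrime :=
  (Ideal.span_singleton_prime hP.ne_zero).mpr hP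

/-- The local ring `A_(P)` mapped into `Ω`. [folklore] -/
def locToΩ (hP : Prime P) :
    letI := isPrime_span_of_prime hP
    Localization.AtPrime (Ideal.span {P} : Ideal (RU s m)) →+* ΩU s m :=
  letI := isPrime_span_of_prime hP
  IsLocalization.lift (M := (Ideal.span {P} : Ideal (RU s m)).primeCompl)
    (g := algebraMap (RU s m) (ΩU s m)) fun y =>
      (IsUnit.mk0 _ fun h => y.2 (by
        have : (y : RU s m) = 0 := algebraMap_ΩU_injective s m (by rw [h, map_zero])
        rw [this]; exact Ideal.zero_mem _))

/-- `locToΩ` extends `A → Ω`. [folklore] -/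
theorem locToΩ_algebraMap (hP : Prime P) (a : RU s m) :
    letI := isPrime_span_of_prime hP
    locToΩ hP (algebraMap (RU s m) (Localization.AtPrime (Ideal.span {P} : Ideal (RU s m))) a) =
      algebraMap (RU s m) (ΩU s m) a := by
  letI := isPrime_span_of_prime hP
  simp [locToΩ, IsLocalization.lift_eq]

/-- `locToΩ` is injective. [folklore] -/
theorem locToΩ_injective (hP : Prime P) :
    letI := isPrime_span_of_prime hP
    Function.Injective (locToΩ hP) := by
  letI := isPrime_span_of_prime hP
  rw [locToΩ, IsLocalization.lift_injective_iff]
  intro x y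
  constructor
  · intro h
    exact congrArg _ (IsLocalization.injective (Localization.AtPrime (Ideal.span {P} : Ideal (RU s m)))
      (Ideal.primeCompl_le_nonZeroDivisors (Ideal.span {P} : Ideal (RU s m))) h)
  · intro h
    rw [algebraMap_ΩU_injective s m h]

/-- **A valuation ring of `Ω` dominating `A_(P)`** (Chevalley's extension theorem). [folklore] -/
def primeSpecVal (hP : Prime P) : ValuationSubring (ΩU s m) :=
  letI := isPrime_span_of_prime hP
  (LocalSubring.exists_le_valuationSubring (LocalSubring.range (locToΩ hP))).choose

/-- `primeSpecVal` dominates `A_(P)`. [folklore] -/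
theorem range_le_primeSpecVal (hP : Prime P) :
    letI := isPrime_span_of_prime hP
    LocalSubring.range (locToΩ hP) ≤ (primeSpecVal hP).toLocalSubring :=
  letI := isPrime_span_of_prime hP
  (LocalSubring.exists_le_valuationSubring (LocalSubring.range (locToΩ hP))).choose_spec

/-- `A ⊆ V_P`. [folklore] -/
theorem algebraMap_mem_primeSpecVal (hP : Prime P) (a : RU s m) :
    algebraMap (RU s m) (ΩU s m) a ∈ primeSpecVal hP := by
  letI := isPrime_span_of_prime hP
  have h := (range_le_primeSpecVal hP).1
  have ha : algebraMap (RU s m) (ΩU s m) a ∈ (LocalSubring.range (locToΩ hP)).toSubring := by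
    rw [LocalSubring.range_toSubring]
    exact ⟨algebraMap (RU s m) _ a, locToΩ_algebraMap hP a⟩
  exact h ha

/-- `A → V_P`. [folklore] -/
def toPrimeSpecVal (hP : Prime P) : RU s m →+* primeSpecVal hP :=
  (algebraMap (RU s m) (ΩU s m)).codRestrict (primeSpecVal hP).toSubring
    (algebraMap_mem_primeSpecVal hP)

/-- `toPrimeSpecVal` followed by the inclusion is `A → Ω`. [folklore] -/
@[simp] theorem coe_toPrimeSpecVal (hP : Prime P) (a : RU s m) :
    ((toPrimeSpecVal hP a : primeSpecVal hP) : ΩU s m) = algebraMap (RU s m) (ΩU s m) a := rfl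

/-- Elements of `A` prime to `P` are units of `V_P`. [folklore] -/
theorem isUnit_toPrimeSpecVal_of_not_dvd (hP : Prime P) {a : RU s m} (ha : ¬ P ∣ a) :
    IsUnit (toPrimeSpecVal hP a) := by
  letI := isPrime_span_of_prime hP
  set L := Localization.AtPrime (Ideal.span {P} : Ideal (RU s m))
  have hac : a ∈ (Ideal.span {P} : Ideal (RU s m)).primeCompl := by
    change a ∉ Ideal.span {P}
    rwa [Ideal.mem_span_singleton]
  obtain ⟨w, hw⟩ := (IsLocalization.AtPrime.isUnit_to_map_iff L (Ideal.span {P}) a).mpr hac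
  have hinv : locToΩ hP (↑w⁻¹ : L) ∈ primeSpecVal hP := by
    refine (range_le_primeSpecVal hP).1 ?_
    rw [LocalSubring.range_toSubring]
    exact ⟨_, rfl⟩
  have e : algebraMap (RU s m) (ΩU s m) a = locToΩ hP (w : L) := by
    rw [hw, locToΩ_algebraMap]
  refine ⟨⟨toPrimeSpecVal hP a, ⟨_, hinv⟩, Subtype.ext ?_, Subtype.ext ?_⟩, rfl⟩
  · change algebraMap (RU s m) (ΩU s m) a * locToΩ hP (↑w⁻¹ : L) = 1
    rw [e, ← map_mul, Units.mul_inv, map_one]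
  · change locToΩ hP (↑w⁻¹ : L) * algebraMap (RU s m) (ΩU s m) a = 1
    rw [e, ← map_mul, Units.inv_mul, map_one]

/-- `P` is NOT a unit of `V_P` (domination). [folklore] -/
theorem not_isUnit_toPrimeSpecVal (hP : Prime P) : ¬ IsUnit (toPrimeSpecVal hP P) := by
  letI := isPrime_span_of_prime hP
  set L := Localization.AtPrime (Ideal.span {P} : Ideal (RU s m))
  intro hu
  obtain ⟨hle, hloc⟩ := range_le_primeSpecVal hP
  have hmem : algebraMap (RU s m) (ΩU s m) P ∈ (LocalSubring.range (locToΩ hP)).toSubring := by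
    rw [LocalSubring.range_toSubring]
    exact ⟨algebraMap (RU s m) L P, locToΩ_algebraMap hP P⟩
  have hu' : IsUnit (Subring.inclusion hle ⟨_, hmem⟩) := hu
  have hu'' := hloc.map_nonunit _ hu'
  obtain ⟨v, hv⟩ := hu''
  -- the inverse lies in the range: `ι(P) · locToΩ x = 1`
  have hvinv : ((↑(v⁻¹) : (LocalSubring.range (locToΩ hP)).toSubring) : ΩU s m) ∈
      (locToΩ hP).range :=
    Eq.mp (congrArg (fun T : Subring (ΩU s m) =>
      ((↑(v⁻¹) : (LocalSubring.range (locToΩ hP)).toSubring) : ΩU s m) ∈ T)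
      (LocalSubring.range_toSubring (locToΩ hP))) (Subtype.property _)
  obtain ⟨x, hx⟩ := hvinv
  have hone : algebraMap (RU s m) (ΩU s m) P * locToΩ hP x = 1 := by
    have h := congrArg (fun y : (LocalSubring.range (locToΩ hP)).toSubring => (y : ΩU s m))
      (Units.mul_inv v)
    simp only [Subring.coe_mul, Subring.coe_one] at h
    rw [hv] at h
    rw [hx]
    exact h
  rw [← locToΩ_algebraMap hP P, ← map_mul, ← (locToΩ hP).map_one] at hone
  have hunit : IsUnit (algebraMap (RU s m) L P) :=
    IsUnit.of_mul_eq_one _ (locToΩ_injective hP hone)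
  rw [IsLocalization.AtPrime.isUnit_to_map_iff L (Ideal.span {P}) P] at hunit
  exact hunit (Ideal.mem_span_singleton_self P)

/-- The field of the specialisation at `P = 0`: an algebraic closure of the residue field of
`V_P`. [folklore] -/
abbrev primeSpecField (hP : Prime P) : Type :=
  AlgebraicClosure (IsLocalRing.ResidueField (primeSpecVal hP))

/-- **The specialisation `φ̄_P : A → k̄_P` at the generic point of `P = 0`.** [folklore] -/
def primeSpecMap (hP : Prime P) : RU s m →+* primeSpecField hP :=
  (algebraMap (IsLocalRing.ResidueField (primeSpecVal hP)) (primeSpecField hP)).comp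
    ((IsLocalRing.residue (primeSpecVal hP)).comp (toPrimeSpecVal hP))

/-- The reduction map `V_P → k̄_P`. [folklore] -/
def primeSpecRed (hP : Prime P) : primeSpecVal hP →+* primeSpecField hP :=
  (algebraMap (IsLocalRing.ResidueField (primeSpecVal hP)) (primeSpecField hP)).comp
    (IsLocalRing.residue (primeSpecVal hP))

/-- `φ̄_P = red ∘ (A → V_P)`. [folklore] -/
theorem primeSpecMap_eq_comp (hP : Prime P) :
    primeSpecMap hP = (primeSpecRed hP).comp (toPrimeSpecVal hP) := rfl

/-- **`ker φ̄_P = (P)`.** [folklore] -/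
theorem ker_primeSpecMap (hP : Prime P) : RingHom.ker (primeSpecMap hP) = Ideal.span {P} := by
  apply le_antisymm
  · intro a ha
    rw [RingHom.mem_ker, primeSpecMap, RingHom.comp_apply, RingHom.comp_apply, map_eq_zero,
      IsLocalRing.residue_eq_zero_iff, IsLocalRing.mem_maximalIdeal, mem_nonunits_iff] at ha
    rw [Ideal.mem_span_singleton]
    by_contra h
    exact ha (isUnit_toPrimeSpecVal_of_not_dvd hP h)
  · rw [Ideal.span_le, Set.singleton_subset_iff, SetLike.mem_coe, RingHom.mem_ker, primeSpecMap,
      RingHom.comp_apply, RingHom.comp_apply, map_eq_zero, IsLocalRing.residue_eq_zero_iff,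
      IsLocalRing.mem_maximalIdeal, mem_nonunits_iff]
    exact not_isUnit_toPrimeSpecVal hP

/-- `φ̄_P(P) = 0`. [folklore] -/
theorem primeSpecMap_self (hP : Prime P) : primeSpecMap hP P = 0 := by
  rw [← RingHom.mem_ker, ker_primeSpecMap hP]
  exact Ideal.mem_span_singleton_self P

/-- `φ̄_P(a) = 0 ↔ P ∣ a`. [folklore] -/
theorem primeSpecMap_eq_zero_iff (hP : Prime P) (a : RU s m) : primeSpecMap hP a = 0 ↔ P ∣ a := by
  rw [← RingHom.mem_ker, ker_primeSpecMap hP, Ideal.mem_span_singleton]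

/-- The residue field of `V_P` has characteristic `0` (`V_P ⊇ ℚ`). [folklore] -/
theorem charZero_residueField_primeSpecVal (hP : Prime P) :
    CharZero (IsLocalRing.ResidueField (primeSpecVal hP)) := by
  refine charZero_of_inj_zero fun n hn => ?_
  by_contra h0
  have hn' : (n : IsLocalRing.ResidueField (primeSpecVal hP)) =
      IsLocalRing.residue (primeSpecVal hP) (toPrimeSpecVal hP (n : RU s m)) := by
    rw [map_natCast, map_natCast]
  rw [hn', IsLocalRing.residue_eq_zero_iff, IsLocalRing.mem_maximalIdeal, mem_nonunits_iff] at hn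
  apply hn
  have hinv : toPrimeSpecVal hP (n : RU s m) * toPrimeSpecVal hP (C ((n : ℚ)⁻¹)) = 1 := by
    rw [← map_mul, ← map_natCast C n, ← map_mul, mul_inv_cancel₀ (by exact_mod_cast h0), C_1,
      map_one]
  exact IsUnit.of_mul_eq_one _ hinv

/-- Hence `k̄_P` has characteristic `0`. [folklore] -/
theorem charZero_primeSpecField (hP : Prime P) : CharZero (primeSpecField hP) := by
  haveI := charZero_residueField_primeSpecVal hP
  infer_instance

variable {𝔭 : Ideal (Rx m)}

/-- **Specialisation of the `u`-resultant identity at the generic point of `P = 0`.** Let `𝔭` be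
a homogeneous prime of dimension `s`, `F` its associated form, `G = uResultant 𝔭 s d Q₀`, and
`P ∈ ℚ[u₁, …, u_s]` prime. Then over `k̄_P`: `F(φ̄_P(u); ·) = cz ∏_{i<D} (bz⁽ⁱ⁾ · u_{s+1})`,
`φ̄_P(G) = cz^d ∏ Q₀(bz⁽ⁱ⁾)`, with every `bz⁽ⁱ⁾ ≠ 0` a zero of (the integer polynomials of) `𝔭` on
the hyperplanes `φ̄_P(u₁), …, φ̄_P(u_s)`. [cite: NesterenkoPhilippon2001, Ch. 3 Prop. 4.11
(pp. 40–41)] -/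
theorem exists_split_primeSpec (h𝔭 : 𝔭.IsPrime)
    (hhom : 𝔭.IsHomogeneous (homogeneousSubmodule (Fin (m + 1)) ℚ))
    (hdim : ringKrullDim (Rx m ⧸ 𝔭) = (s + 1 : ℕ)) {d : ℕ} {Q₀ : MvPolynomial (Fin (m + 1)) ℤ}
    (hQ : Q₀.IsHomogeneous d) (hP : Prime P) :
    ∃ (cz : primeSpecField hP) (bz : Fin (ideg 𝔭 (s + 1)) → Fin (m + 1) → primeSpecField hP),
      (∀ i, bz i ≠ 0) ∧
      (∀ i, ∀ Z : MvPolynomial (Fin (m + 1)) ℤ, MvPolynomial.map (Int.castRingHom ℚ) Z ∈ 𝔭 →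
        aeval (bz i) Z = 0) ∧
      (∀ i (i' : Fin s), ∑ j, primeSpecMap hP (X (i', j)) * bz i j = 0) ∧
      MvPolynomial.map (primeSpecMap hP) (splitLast s m (chowForm 𝔭 (s + 1))) =
        C cz * ∏ i, (∑ j, C (bz i j) * X j) ∧
      primeSpecMap hP (uResultant 𝔭 s d Q₀) = cz ^ d * ∏ i, aeval (bz i) Q₀ := by
  set V := primeSpecVal hP with hV
  obtain ⟨hc, hβsec, hF⟩ := splitConst_spec h𝔭 hhom hdim
  have hcoeff : ∀ e, coeff e (chowFormΩ 𝔭 s) ∈ V := fun e => by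
    obtain ⟨a, ha⟩ := coeff_chowFormΩ_mem_range 𝔭 s e
    rw [← ha]
    exact algebraMap_mem_primeSpecVal hP a
  obtain ⟨c₁, β₁, hc₁, hone, hprop, hsplit, hnorm⟩ :=
    exists_integral_split V hc (fun i => (hβsec i).1) hF hcoeff hQ
  -- the identities inside `V`
  have hinjmap : Function.Injective (MvPolynomial.map (σ := Fin (m + 1)) V.subtype) :=
    map_injective _ Subtype.coe_injective
  have hFV : MvPolynomial.map (toPrimeSpecVal hP) (splitLast s m (chowForm 𝔭 (s + 1))) =
      C c₁ * ∏ i, (∑ j, C (β₁ i j) * X j) := by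
    apply hinjmap
    rw [map_map, map_C_mul_prod_lin']
    exact hsplit
  have hGV : toPrimeSpecVal hP (uResultant 𝔭 s d Q₀) = c₁ ^ d * ∏ i, aeval (β₁ i) Q₀ := by
    apply Subtype.coe_injective
    change algebraMap (RU s m) (ΩU s m) (uResultant 𝔭 s d Q₀) = _
    rw [algebraMap_uResultant h𝔭 hhom hdim hQ]
    exact hnorm
  -- reduce modulo the maximal ideal
  set ψ := primeSpecRed hP with hψ
  refine ⟨ψ c₁, fun i j => ψ (β₁ i j), fun i => ?_, fun i => ?_, fun i i' => ?_, ?_, ?_⟩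
  · obtain ⟨j, hj⟩ := hone i
    intro h
    have : ψ (β₁ i j) = 0 := congrFun h j
    rw [hj, map_one] at this
    exact one_ne_zero this
  · refine forall_aeval_map_eq_zero V.toSubring ψ (β₁ i) ?_
    obtain ⟨a, -, ha⟩ := hprop i
    rw [ha]
    exact forall_aeval_smul_eq_zero hhom (hβsec i).2.1 a
  · obtain ⟨a, -, ha⟩ := hprop i
    have hΩ : ∑ j, ((β₁ i j : V) : ΩU s m) * uΩ s m (i', j) = 0 := by
      have h2 := (hβsec i).2.2 i'
      have h3 : ∀ j, ((β₁ i j : V) : ΩU s m) = a * splitPts 𝔭 s i j := fun j => by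
        have := congrFun ha j
        simpa using this
      simp_rw [h3, mul_assoc, ← Finset.mul_sum, h2, mul_zero]
    have hVsum : ∑ j, β₁ i j * toPrimeSpecVal hP (X (i', j)) = 0 := by
      apply Subtype.coe_injective
      change V.subtype (∑ j, β₁ i j * toPrimeSpecVal hP (X (i', j))) = ((0 : V) : ΩU s m)
      rw [map_sum]
      simpa [map_mul, uΩ] using hΩ
    have h4 := congrArg ψ hVsum
    rw [map_sum, map_zero] at h4
    rw [← h4]
    refine Finset.sum_congr rfl fun j _ => ?_
    rw [map_mul, primeSpecMap_eq_comp, RingHom.comp_apply, mul_comm]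
  · rw [primeSpecMap_eq_comp, ← map_map, hFV, map_C_mul_prod_lin']
  · rw [primeSpecMap_eq_comp, RingHom.comp_apply, hGV, map_mul, map_pow, map_prod]
    congr 1
    exact Finset.prod_congr rfl fun i _ => map_aeval_int ψ Q₀ (β₁ i)

end PrimeSpec

/-! ### Specialisation at a generic complex point -/

section ComplexSpec

variable {s : ℕ} {𝔭 : Ideal (Rx m)}

/-- **An embedding `Ω → ℂ` over a generic complex point.** If `u ↦ z` is injective on
`A = ℚ[u₁, …, u_s]`, it extends to a ring homomorphism `ψ : Ω = ℚ(u₁, …, u_s)‾ → ℂ`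
(`IsFractionRing.lift`, `IsAlgClosed.lift`). [folklore] -/
theorem exists_ringHom_ΩU_complex {z : Fin s × Fin (m + 1) → ℂ}
    (hz : Function.Injective (aeval z : RU s m →ₐ[ℚ] ℂ)) :
    ∃ ψ : ΩU s m →+* ℂ, ∀ a : RU s m, ψ (algebraMap (RU s m) (ΩU s m) a) = aeval z a := by
  set f : KU s m →+* ℂ := IsFractionRing.lift (g := (aeval z : RU s m →ₐ[ℚ] ℂ).toRingHom) hz
    with hf
  letI : Algebra (KU s m) ℂ := f.toAlgebra
  haveI : FaithfulSMul (KU s m) ℂ :=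
    (faithfulSMul_iff_algebraMap_injective (KU s m) ℂ).mpr f.injective
  let ψ₀ : ΩU s m →ₐ[KU s m] ℂ := IsAlgClosed.lift (R := KU s m) (M := ℂ) (S := ΩU s m)
  refine ⟨(ψ₀ : ΩU s m →+* ℂ), fun a => ?_⟩
  rw [IsScalarTower.algebraMap_apply (RU s m) (KU s m) (ΩU s m), AlgHom.coe_toRingHom,
    AlgHom.commutes]
  change f (algebraMap (RU s m) (KU s m) a) = _
  rw [hf, IsFractionRing.lift_algebraMap]
  rfl

/-- **Specialisation of the `u`-resultant identity at a generic complex point.** Let `𝔭` be a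
homogeneous prime of dimension `s`, `F` its associated form, `G = uResultant 𝔭 s d Q₀`, and
`z ∈ ℂ^{s(m+1)}` a point at which `u ↦ z` is injective on `ℚ[u₁, …, u_s]`. Then
`F(z; ·) = ĉ ∏_{i<D} (β̂⁽ⁱ⁾ · u_{s+1})` and `G(z) = ĉ^d ∏ Q₀(β̂⁽ⁱ⁾)` with `ĉ ≠ 0` and every
`β̂⁽ⁱ⁾ ∈ ℂ^{m+1} ∖ 0` a zero of `𝔭` on the hyperplanes `z₁, …, z_s`.
[cite: NesterenkoPhilippon2001, Ch. 3 Prop. 4.11 (pp. 40–41)] -/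
theorem exists_split_complexSpec (h𝔭 : 𝔭.IsPrime)
    (hhom : 𝔭.IsHomogeneous (homogeneousSubmodule (Fin (m + 1)) ℚ))
    (hdim : ringKrullDim (Rx m ⧸ 𝔭) = (s + 1 : ℕ)) {d : ℕ} {Q₀ : MvPolynomial (Fin (m + 1)) ℤ}
    (hQ : Q₀.IsHomogeneous d) {z : Fin s × Fin (m + 1) → ℂ}
    (hz : Function.Injective (aeval z : RU s m →ₐ[ℚ] ℂ)) :
    ∃ (cz : ℂ) (bz : Fin (ideg 𝔭 (s + 1)) → Fin (m + 1) → ℂ), cz ≠ 0 ∧ (∀ i, bz i ≠ 0) ∧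
      (∀ i, ∀ P ∈ 𝔭, aeval (bz i) P = 0) ∧
      (∀ i (i' : Fin s), ∑ j, z (i', j) * bz i j = 0) ∧
      MvPolynomial.map (aeval z : RU s m →ₐ[ℚ] ℂ) (splitLast s m (chowForm 𝔭 (s + 1))) =
        C cz * ∏ i, (∑ j, C (bz i j) * X j) ∧
      aeval z (uResultant 𝔭 s d Q₀) = cz ^ d * ∏ i, aeval (bz i) Q₀ := by
  obtain ⟨ψ, hψ⟩ := exists_ringHom_ΩU_complex hz
  obtain ⟨hc, hβsec, hF⟩ := splitConst_spec h𝔭 hhom hdim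
  have hψinj : Function.Injective ψ := ψ.injective
  have hcomp : ψ.comp (algebraMap (RU s m) (ΩU s m)) =
      ((aeval z : RU s m →ₐ[ℚ] ℂ) : RU s m →+* ℂ) := RingHom.ext hψ
  refine ⟨ψ (splitConst 𝔭 s), fun i j => ψ (splitPts 𝔭 s i j), ?_, fun i => ?_, fun i => ?_,
    fun i i' => ?_, ?_, ?_⟩
  · exact fun h => hc (hψinj (by rw [h, map_zero]))
  · intro h
    apply (hβsec i).1
    funext j
    exact hψinj (by rw [Pi.zero_apply, map_zero]; exact congrFun h j)
  · intro P hP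
    -- `ψ` is a `ℚ`-algebra map
    have e : aeval (fun j => ψ (splitPts 𝔭 s i j)) P = ψ (aeval (splitPts 𝔭 s i) P) := by
      rw [map_aeval, aeval_def]
      congr 1
      exact (RingHom.ext_rat (ψ.comp (algebraMap ℚ (ΩU s m))) (algebraMap ℚ ℂ)).symm
    rw [e, (hβsec i).2.1 P hP, map_zero]
  · have h := congrArg ψ ((hβsec i).2.2 i')
    rw [map_sum, map_zero] at h
    rw [← h]
    refine Finset.sum_congr rfl fun j _ => ?_
    rw [map_mul, uΩ, hψ, aeval_X, mul_comm]
  · rw [← hcomp, ← map_map]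
    change MvPolynomial.map ψ (chowFormΩ 𝔭 s) = _
    rw [hF, map_C_mul_prod_lin]
  · rw [← hψ, algebraMap_uResultant h𝔭 hhom hdim hQ, uResΩ, map_splitNorm, splitNorm_def]

end ComplexSpec

end Nesterenko

end Literature.NumberTheory.Transcendental

end
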